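import Summits.Ventures.PercRepro.RankLevelSetExplicitLin2KeyL

/-!
# PercRepro — THE LEVEL-10 THEOREM-M ROW OF C-025 OVER THE 5/8 RANGE: THE KEY AT `p = 1 089` (p9, S4; the key is p4's)

`proofs/SUBCLAIM-S4-p9.md` §S4.2⁗⁗. p4's THEOREM-M key `KeyL 10 p d` (RankLevelSetExplicitLin2KeyL) checked by the kernel at
`p = 1 089` on the coranks `11 ≤ d ≤ 650` of THE 5/8 RANGE (`D' = 10 + 5·2^{7} = 650`; the large-corank theorem
`c025_core_explicit_large_of58` takes the coranks beyond): `1 089` = the least `p` with the optimal Chernoff pair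
`16·n^n ≤ 2^n·(n − K)^{n−K}·K^K` at `n = p + D'`, `K = 10 + D'` (twin lean-drafts/p9/g7/twin/range58.py), at or above the key's
own floor and the bases `N₁ = 731`, `P₂ = 672` (RankLevelSetExplicitLin2Bases58); p4's sharp row sits at `1 165`
(RankLevelSetExplicitLin2IndepFloorS). The level step and the unconditional chain are RankLevelSetExplicitLin2IndepFloor58.
Axioms: standard (kernel `decide`).
-/

namespace PercRepro

namespace ThmN

namespace Explicit

/-- **THE THEOREM-M KEY ROW AT `(q, p) = (10, 1 089)` OVER THE 5/8 RANGE**: `KeyL 10 1089 d` at every corank `11 ≤ d ≤ 650`, by the kernel. -/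
theorem key_ten_indep58_row : ∀ t < 640, KeyL 10 1089 (11 + t) := by decide +kernel

end Explicit

end ThmN

end PercRepro
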